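import Literature.Geometry.Kaehler.ComplexTorusWeilNoSurfaces
import Literature.Geometry.Kaehler.ComplexTorusSimpleNonAlgebraicSubvarieties
import Literature.Barriers.HodgeConjecture.KaehlerCoherentSheavesSplit
import HarnessLib

/-!
# Voisin's torus of Weil type: the barrier fact `Voisin2002_weilTorus_hodgeClassWithoutSubvarieties` HOLDS

Layer `Literature/Barriers/HodgeConjecture`; lane `lit-hodgefound` (Track 2 foundations library), Layer A4, row A4-108
(FILE C) of `run/shared/lean/pub/lit-hodgefound/SKELETON.md` (seat skel-4).

The named barrier fact `Literature.Barriers.HodgeConjecture.Voisin2002_weilTorus_hodgeClassWithoutSubvarieties`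
(`KaehlerCoherentSheaves.lean`: a compact connected Kähler manifold charted on `ℂ⁴` with `NS = 0`, every closed
analytic subset `≠ X` finite, and a non-zero rational `(2,2)`-class — Voisin, IMRN 2002, Thm. 1 / §3 Prop. 3) was
reduced in the tree (`KaehlerCoherentSheavesAssemblyProofs.lean`,
`Voisin2002_weilTorus_hodgeClassWithoutSubvarieties_of_leaves`) to two inputs: de Rham's theorem in the family form
(`exists_complexDeRhamIsoFamily_holds`, proved) and Voisin's assumption (b) for the explicit torus of Weil type
`X = ℂ⁴/Φ(ℤ⁸)`, `Φ = Weil.periodEquiv` — so far available only through the unproved child "Ueno 1975"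
(`KaehlerCoherentSheavesSplit.lean`). Assumption (b) is now PROVED for this torus by the cycle-class route
(`Weil.analyticSubsetsFinite`, file `ComplexTorusWeilNoSurfaces.lean`: `B¹ = B³ = 0`, `B² =` the Weil plane whose
classes change sign on complex `2`-planes, dimension theory), whence the discharge

  `Voisin2002_weilTorus_hodgeClassWithoutSubvarieties_holds : Voisin2002_weilTorus_hodgeClassWithoutSubvarieties`.

Corollary (the tree's `not_kaehlerSubvarietiesOrLineBundlesDetectClasses`, which took the fact as a hypothesis): on
compact Kähler fourfolds charted on `ℂ⁴`, Hodge classes of degree `4` are NOT accounted for by subvarieties and line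
bundles (`not_kaehlerSubvarietiesOrLineBundlesDetectClasses_fin4`).

No new definition, no named fact, no instance, no notation. Net debt delta `−1`.

## The child `Ueno1975_analyticSubsetsFinite_of_isSimple`: proved instances (appended, rows A4-109/A4-110)

The child named fact of `KaehlerCoherentSheavesSplit.lean`, `Ueno1975_analyticSubsetsFinite_of_isSimple Φ :
IsSimple Φ → ¬ IsAbelianVariety Φ → AnalyticSubsetsFinite Φ` (Ueno, LNM 439 §10, Lemma 10.8 / Thm. 10.9: a simple
complex torus which is not an abelian variety contains no proper closed analytic subset of positive dimension), stays
a named fact in general (its proof needs Ueno's structure theory of subvarieties — Kodaira dimension, Albanese/Jacobian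
algebraicity). It is PROVED here in the following cases, all through the tree's cycle classes:
* for the explicit torus of Weil type, `ueno1975_analyticSubsetsFinite_of_isSimple_weil` (the conclusion holds
  outright: `Weil.analyticSubsetsFinite`, row A4-108) — so the route of `KaehlerCoherentSheavesSplit.lean`
  (`Voisin2002_weilTorus_hodgeClassWithoutSubvarieties_holds_of`) is closed as well;
* for every Hodge-generic torus `Hg(X) = SL(V)`, `ueno1975_analyticSubsetsFinite_of_isSimple_of_hodgeGroup_eq_top`
  (row A4-109, `ComplexTorusHodgeGenericNoSubvarieties.lean`: no Hodge classes in the intermediate degrees, hence no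
  subvarieties; such a torus IS simple and, for `g ≥ 2`, not an abelian variety);
* for EVERY complex torus of dimension `≤ 2`, `ueno1975_analyticSubsetsFinite_of_isSimple_of_finrank_le_two` (row
  A4-110, `ComplexTorusSimpleNonAlgebraicSubvarieties.lean`: a simple non-algebraic `2`-torus carries no curve — Ueno's
  theorem in dimension two, via p07's `isAbelianVariety_or_not_isSimple_of_curve`), and in every dimension the
  codimension-one part (`ComplexTorus.IsSimple.not_hasPureCodim_one`: no analytic hypersurface).

## References

* [Ueno1975] K. Ueno, *Classification Theory of Algebraic Varieties and Compact Complex Spaces*, LNM 439 (1975),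
  §10: Thm. 10.3, Lemma 10.8, Thm. 10.9.

* [Voisin2002KaehlerCounterexample] C. Voisin, *A counterexample to the Hodge conjecture extended to Kähler
  varieties*, IMRN 2002 no. 20, 1057–1075, Thm. 1, §2 (a)–(b), §3 Prop. 3.
-/

noncomputable section

open scoped Manifold

namespace Literature.Barriers.HodgeConjecture

open Literature.Geometry.Kaehler

/-- **VOISIN'S BARRIER FACT HOLDS**: there is a compact connected Kähler fourfold charted on `ℂ⁴` — the explicit
complex torus of Weil type `X = ℂ⁴/Φ(ℤ⁸)` — with `NS(X) = 0`, no proper closed analytic subset of positive dimension,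
and a non-zero rational Hodge class of degree `4` (Voisin 2002, Thm. 1 with §3 Prop. 3). Assembled from de Rham's
theorem (`exists_complexDeRhamIsoFamily_holds`) and assumption (b) proved by cycle classes (`Weil.analyticSubsetsFinite`).
[cite: Voisin2002KaehlerCounterexample, Thm. 1, §2 (a)–(b), §3 Prop. 3] -/
theorem Voisin2002_weilTorus_hodgeClassWithoutSubvarieties_holds : Voisin2002_weilTorus_hodgeClassWithoutSubvarieties :=
  Voisin2002_weilTorus_hodgeClassWithoutSubvarieties_of_leaves
    (Literature.NumberTheory.Transcendental.exists_complexDeRhamIsoFamily_holds (Fin 4 → ℂ)) Weil.analyticSubsetsFinite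

/-- **Corollary: on compact Kähler manifolds charted on `ℂ⁴`, subvarieties and line bundles do NOT detect the Hodge
classes of degree four** (the tree's conditional refutation `not_kaehlerSubvarietiesOrLineBundlesDetectClasses`, now
unconditional). [cite: Voisin2002KaehlerCounterexample, §1 and §3 Prop. 3] -/
theorem not_kaehlerSubvarietiesOrLineBundlesDetectClasses_fin4 :
    ¬ KaehlerSubvarietiesOrLineBundlesDetectClasses (Fin 4 → ℂ) :=
  not_kaehlerSubvarietiesOrLineBundlesDetectClasses Voisin2002_weilTorus_hodgeClassWithoutSubvarieties_holds

/-! ### The child `Ueno1975_analyticSubsetsFinite_of_isSimple` in the cases proved by cycle classes -/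

/-- **Ueno's statement holds for the explicit torus of Weil type** `X = ℂ⁴/Φ(ℤ⁸)`: its conclusion
`AnalyticSubsetsFinite Weil.periodEquiv` is the tree's `Weil.analyticSubsetsFinite` (row A4-108: `B¹ = B³ = 0`, `B² =`
the Weil plane). [cite: Voisin2002KaehlerCounterexample, §3 p. 1063 and Prop. 3] [cite: Ueno1975, §10 Thm. 10.9] -/
theorem ueno1975_analyticSubsetsFinite_of_isSimple_weil :
    Ueno1975_analyticSubsetsFinite_of_isSimple Weil.periodEquiv :=
  fun _ _ ↦ Weil.analyticSubsetsFinite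

/-- **Ueno's statement holds for every Hodge-generic complex torus** (`Hg(X) = SL(H₁(X, ℚ))`): there every closed
analytic subset `≠ X` is finite outright (`ComplexTorus.analyticSubsetsFinite_of_hodgeGroup_eq_top`, row A4-109).
[cite: Lange2023AbelianVarietiesComplex, §7.2.2 Thm. 7.2.4] [cite: Ueno1975, §10 Thm. 10.9] -/
theorem ueno1975_analyticSubsetsFinite_of_isSimple_of_hodgeGroup_eq_top {ι : Type*} {E : Type*}
    [NormedAddCommGroup E] [NormedSpace ℂ E] [FiniteDimensional ℂ E] [Fintype ι] [DecidableEq ι]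
    (Φ : (ι → ℝ) ≃L[ℝ] E) (h : ComplexTorus.hodgeGroup Φ = ⊤) : Ueno1975_analyticSubsetsFinite_of_isSimple Φ :=
  fun _ _ ↦ ComplexTorus.analyticSubsetsFinite_of_hodgeGroup_eq_top Φ h

/-- **UENO'S THEOREM FOR COMPLEX TORI OF DIMENSION `≤ 2` (the child PROVED for every such torus)**: a simple complex
torus of dimension `≤ 2` which is not an abelian variety contains no proper closed analytic subset of positive dimension
(`ComplexTorus.analyticSubsetsFinite_of_isSimple_of_finrank_le_two`, row A4-110: a curve on a simple `2`-torus makes it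
an abelian surface). [cite: Ueno1975, §10 Thm. 10.3, Lemma 10.8 and Thm. 10.9]
[cite: Lange2023AbelianVarietiesComplex, §2.1.3 Prop. 2.1.11 and §1.5.4 (1.22)] -/
theorem ueno1975_analyticSubsetsFinite_of_isSimple_of_finrank_le_two {ι : Type*} {E : Type*}
    [NormedAddCommGroup E] [NormedSpace ℂ E] [Fintype ι] (Φ : (ι → ℝ) ≃L[ℝ] E)
    (h2 : Module.finrank ℂ E ≤ 2) : Ueno1975_analyticSubsetsFinite_of_isSimple Φ := by
  classical
  haveI : FiniteDimensional ℝ E := LinearEquiv.finiteDimensional Φ.toLinearEquiv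
  haveI : FiniteDimensional ℂ E := Module.Finite.of_restrictScalars_finite ℝ ℂ E
  exact fun hS hna ↦ ComplexTorus.analyticSubsetsFinite_of_isSimple_of_finrank_le_two Φ h2 hS hna

/-- In every dimension, the codimension-one part of Ueno's statement: **a simple complex torus which is not an abelian
variety carries no analytic hypersurface** (`ComplexTorus.IsSimple.not_hasPureCodim_one`, row A4-110).
[cite: Ueno1975, §10 Lemma 10.8 and Thm. 10.9] [cite: Voisin2002KaehlerCounterexample, §3 p. 1063] -/
theorem not_hasPureCodim_one_of_isSimple_of_not_isAbelianVariety {ι : Type*} {E : Type*}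
    [NormedAddCommGroup E] [NormedSpace ℂ E] [Fintype ι] (Φ : (ι → ℝ) ≃L[ℝ] E) (hS : ComplexTorus.IsSimple Φ)
    (hna : ¬ ComplexTorus.IsAbelianVariety Φ) (D : Set (ComplexTorus Φ)) : ¬ HasPureCodim 𝓘(ℂ, E) D 1 := by
  classical
  haveI : FiniteDimensional ℝ E := LinearEquiv.finiteDimensional Φ.toLinearEquiv
  haveI : FiniteDimensional ℂ E := Module.Finite.of_restrictScalars_finite ℝ ℂ E
  exact hS.not_hasPureCodim_one Φ hna D

end Literature.Barriers.HodgeConjecture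

end
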